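import Mathlib
import HarnessLib
import Literature.Analysis.FluidPDE.KochTataru
import Literature.Analysis.FluidPDE.KochTataruKernel
import Literature.Analysis.FluidPDE.UlocKernelEstimates

/-!
# Route `PoloidalWindowDoor`, crux `PoloidalWindowRigidity` (stmt-NavierStokesRegularity-19708) — LINE 16 «zero_mode» (ns-idea-8 g8, v1.1), stub Z-oseen
# `stub_zeroModeOseen`, RADIAL STEP: the Koch–Tataru weight `k_σ(z) = (σ + ‖z‖²)^{-2}` on `E3` has mass `M₀ σ^{-1/2}` and TAIL `∫_{‖z‖≥r} k_σ ≤ 4M₀/r`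

Cell ns-regularity-ideate, seat ns-poloidal-K2-p2 g12 (K2 hand).  Helper file (no stub closed here) for the L-sized stub Z-oseen of LINE 16: the two radial
integrals that drive the three-region estimate of the box integral of the Oseen–Duhamel term (`‖K(σ,z)[a,b]‖ ≤ C_K k_σ(z)‖a‖‖b‖`,
`exists_norm_oseenKernel_le` with `d = 3`), with `M₀ = ∫ (1+‖w‖²)^{-2} dw > 0` (`integral_weight_one_pos`):

* `lintegral_weight_eq`: `∫ k_σ = M₀ σ^{-1/2}` for `σ > 0` (tree `lintegral_add_norm_sq_rpow_neg`, `d = 3`, `e = 2`);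
* `lintegral_weight_tail_le`: `∫_{‖z‖ ≥ r} k_σ ≤ 4M₀/r` for `σ ≥ 0`, `r > 0` — on `‖z‖ ≥ r` one has `σ + ‖z‖² ≥ (r² + ‖z‖²)/2`, so `k_σ ≤ 4k_{r²}`
  pointwise there, and `∫ k_{r²} = M₀/r`; no polar coordinates and no logarithm are needed.

USE (route of Z-oseen WITHOUT layer-cake, recorded for the hand that continues): split `y ∈ Q₋ᵣ` (inner box: `∫_Q K(σ,·−y) = −∫_{Qᶜ} K(σ,·−y)` by the
zero space integral `Literature.Analysis.FluidPDE.integral_oseenKernel_eq_zero` (KNSSRemark61) and `dist(y, Qᶜ) ≥ r` ⇒ tail), `y ∈ Q₊ᵣ ∖ Q₋ᵣ` (mass bound,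
shell volume `o(|Q|)`), `y ∉ Q₊ᵣ` (direct bound, Tonelli swap, tail) ⇒ `∫_y‖∫_{x∈Q}K(σ,x−y)[a(y),b(y)]dx‖dy ≤ C_K M²(8M₀|Q|/r + M₀σ^{-1/2}|Q₊ᵣ∖Q₋ᵣ|)`, then
the time integral `∫_s^t` (`(t−s)/r` and `2√(t−s)`), `r := r(ε)`, `L₀ := L₀(r, ε)`.

WHAT THIS IS NOT: Z-oseen itself; 19708 / 20428 / ⟨27893⟩ OPEN; no claim about Navier–Stokes regularity.
-/

noncomputable section

-- the summit and its single sub-problem share the name (CONVENTIONS §1), as in every Theorems file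
set_option linter.dupNamespace false

namespace Summit.NavierStokesRegularity.NavierStokesRegularity.Theorems.PoloidalWindowDoorPoloidalWindowRigidityZeroModeRadial

open MeasureTheory Set Function Filter Topology
open scoped RealInnerProductSpace ENNReal
open Literature.Analysis Literature.Analysis.FluidPDE Literature.Analysis.UnboundedOperators

/-! ## Radial integrals of the weight `k_σ(z) = (σ + ‖z‖²)^{-2}` on `E3` -/

/-- The normalising constant `M₀ = ∫ (1 + ‖w‖²)^{-2} dw` is positive. [folklore] -/
theorem integral_weight_one_pos : 0 < ∫ w : EuclideanSpace ℝ (Fin 3), (1 + ‖w‖ ^ 2) ^ (-(2 : ℝ)) :=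
  integral_one_add_norm_sq_rpow_neg_pos (by rw [finrank_real_euclideanSpace_fin_three]; norm_num)

/-- **`∫ k_σ = M₀ σ^{-1/2}`** (parabolic scaling, tree `lintegral_add_norm_sq_rpow_neg` with `d = 3`, `e = 2`). [folklore] -/
theorem lintegral_weight_eq {σ : ℝ} (hσ : 0 < σ) :
    ∫⁻ z : EuclideanSpace ℝ (Fin 3), ENNReal.ofReal ((σ + ‖z‖ ^ 2) ^ (-(2 : ℝ))) =
      ENNReal.ofReal (σ ^ (-(1 / 2 : ℝ)) * ∫ w : EuclideanSpace ℝ (Fin 3), (1 + ‖w‖ ^ 2) ^ (-(2 : ℝ))) := by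
  rw [lintegral_add_norm_sq_rpow_neg (by rw [finrank_real_euclideanSpace_fin_three]; norm_num) hσ, finrank_real_euclideanSpace_fin_three]
  norm_num

/-- **The tail of the weight**: `∫_{‖z‖ ≥ r} k_σ ≤ 4M₀/r` for `σ ≥ 0`, `r > 0` (on `‖z‖ ≥ r`, `σ + ‖z‖² ≥ (r² + ‖z‖²)/2`, so
`k_σ ≤ 4 k_{r²}`, and `∫ k_{r²} = M₀/r`). [folklore] -/
theorem lintegral_weight_tail_le {σ r : ℝ} (hσ : 0 ≤ σ) (hr : 0 < r) :
    ∫⁻ z in {z : EuclideanSpace ℝ (Fin 3) | r ≤ ‖z‖}, ENNReal.ofReal ((σ + ‖z‖ ^ 2) ^ (-(2 : ℝ))) ≤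
      ENNReal.ofReal (4 * (∫ w : EuclideanSpace ℝ (Fin 3), (1 + ‖w‖ ^ 2) ^ (-(2 : ℝ))) / r) := by
  set M₀ : ℝ := ∫ w : EuclideanSpace ℝ (Fin 3), (1 + ‖w‖ ^ 2) ^ (-(2 : ℝ)) with hM₀
  have hpt : ∀ z ∈ {z : EuclideanSpace ℝ (Fin 3) | r ≤ ‖z‖},
      ENNReal.ofReal ((σ + ‖z‖ ^ 2) ^ (-(2 : ℝ))) ≤ ENNReal.ofReal (4 * (r ^ 2 + ‖z‖ ^ 2) ^ (-(2 : ℝ))) := by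
    intro z hz
    refine ENNReal.ofReal_le_ofReal ?_
    have hz2 : r ^ 2 ≤ ‖z‖ ^ 2 := pow_le_pow_left₀ hr.le hz 2
    have hpos : 0 < σ + ‖z‖ ^ 2 := by nlinarith
    have hpos' : 0 < r ^ 2 + ‖z‖ ^ 2 := by positivity
    rw [Real.rpow_neg hpos.le, Real.rpow_neg hpos'.le, Real.rpow_two, Real.rpow_two]
    rw [show (4 : ℝ) * ((r ^ 2 + ‖z‖ ^ 2) ^ 2)⁻¹ = (((r ^ 2 + ‖z‖ ^ 2) / 2) ^ 2)⁻¹ by field_simp; ring]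
    exact inv_anti₀ (by positivity) (pow_le_pow_left₀ (by positivity) (by nlinarith) 2)
  calc ∫⁻ z in {z : EuclideanSpace ℝ (Fin 3) | r ≤ ‖z‖}, ENNReal.ofReal ((σ + ‖z‖ ^ 2) ^ (-(2 : ℝ)))
      ≤ ∫⁻ z in {z : EuclideanSpace ℝ (Fin 3) | r ≤ ‖z‖}, ENNReal.ofReal (4 * (r ^ 2 + ‖z‖ ^ 2) ^ (-(2 : ℝ))) :=
        setLIntegral_mono' (measurableSet_le measurable_const measurable_norm) hpt
    _ ≤ ∫⁻ z, ENNReal.ofReal (4 * (r ^ 2 + ‖z‖ ^ 2) ^ (-(2 : ℝ))) := setLIntegral_le_lintegral _ _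
    _ = ENNReal.ofReal 4 * ∫⁻ z : EuclideanSpace ℝ (Fin 3), ENNReal.ofReal ((r ^ 2 + ‖z‖ ^ 2) ^ (-(2 : ℝ))) := by
        rw [← lintegral_const_mul' _ _ ENNReal.ofReal_ne_top]
        refine lintegral_congr fun z => ?_
        rw [← ENNReal.ofReal_mul (by norm_num)]
    _ = ENNReal.ofReal 4 * ENNReal.ofReal ((r ^ 2) ^ (-(1 / 2 : ℝ)) * M₀) := by rw [lintegral_weight_eq (by positivity)]
    _ = ENNReal.ofReal (4 * M₀ / r) := by
        rw [← ENNReal.ofReal_mul (by norm_num)]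
        congr 1
        have hr2 : (r ^ 2) ^ (-(1 / 2 : ℝ)) = r⁻¹ := by
          rw [Real.rpow_neg (sq_nonneg r), ← Real.sqrt_eq_rpow, Real.sqrt_sq hr.le]
        rw [hr2]
        field_simp

end Summit.NavierStokesRegularity.NavierStokesRegularity.Theorems.PoloidalWindowDoorPoloidalWindowRigidityZeroModeRadial

end
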